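import Literature.Barriers.AtomisticToContinuum.AnticontinuumLocalizationSections
import Literature.Barriers.AtomisticToContinuum.AnticontinuumLocalizationConfigDecorrelation
import Literature.Barriers.AtomisticToContinuum.AnticontinuumLocalizationStationarity
import Mathlib.Probability.Independence.Integration
import Mathlib.MeasureTheory.Integral.MeanInequalities
import HarnessLib

/-!
# Discharge of `DeRoeckHuveneers2015_decorrelation` (De Roeck–Huveneers 2015, eq. (7.1)); Theorem 2 from Theorem 1 alone

`Literature/Barriers/AtomisticToContinuum/`. The named fact `DeRoeckHuveneers2015_decorrelation`
(`AnticontinuumLocalizationThm2.lean`) — the decorrelation inequality (7.1) of De Roeck–Huveneers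
for the Gibbs state `⟨·⟩_T` of the rotor chain: for `γ ≥ 0`, `T > 0` and all small `ε`, smooth
local periodic zero-mean `f, g` satisfy
`|⟨fg⟩_T| ≤ C e^{-c(|a-b| - R_f - R_g)} ⟨|∇f|²⟩_T^{1/2} ⟨|∇g|²⟩_T^{1/2}` uniformly in `N` — is
PROVED here (`DeRoeckHuveneers2015_decorrelation_holds`), by the ASSEMBLY
`DeRoeckHuveneers2015_decorrelation_of_config` of

* the configurational case `DeRoeckHuveneers2015_decorrelation_config_holds`
  (`AnticontinuumLocalizationConfigDecorrelation.lean`: the one-dimensional transfer-operator /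
  martingale method of `Literature/Probability/LatticeModels/WeaklyCoupledChain*.lean`), and
* the Gaussian Poincaré inequality in the momenta (`integral_sq_avgQ_le`,
  `AnticontinuumLocalizationSections.lean`, from
  `Literature/Probability/Distributions/GaussianPoincare.lean`),

using the product structure `⟨·⟩_T = ν_{N,ε/T,γ} ⊗ 𝒩(0,T)^{⊗N}` (`gibbsMeasure_eq_prod`):
`⟨fg⟩ = ∫ Cov_ν(f(·,ω), g(·,ω)) dG(ω) + ∫ F̄ Ḡ dG`; the first term is bounded fibrewise by the
configurational inequality and integrated by Cauchy–Schwarz; in the second, `F̄(ω) = ∫ f(q,ω)dν`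
and `Ḡ` depend on the momenta in the two windows only, so for disjoint windows they are
independent under the product Gaussian and the term vanishes (`⟨f⟩ = ⟨g⟩ = 0`), while for
overlapping windows (`|a - b| ≤ R_f + R_g`, no decay claimed) it is at most
`‖F̄‖₂‖Ḡ‖₂ ≤ (π²T/4) ⟨|∇_ω f|²⟩^{1/2} ⟨|∇_ω g|²⟩^{1/2}`. Constants: `C_d = max(C,0) + π²T/4`, the
same rate `c`, `ε₁ = β₁ T`.

Consequently (`DeRoeckHuveneers2015_thm2_of_thm1`) the barrier fact `DeRoeckHuveneers2015_thm2`
follows from Theorem 1 of the paper ALONE (`DeRoeckHuveneers2015_thm1`, its main theorem,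
§§3–6), every other input of the printed proof of Theorem 2 (§7) being formalized: stationarity of
the Gibbs state (`GibbsStationarity_holds`) and the decorrelation inequality (7.1) (this file).
No definitions.
-/

noncomputable section

open MeasureTheory ProbabilityTheory Function Set Filter
open scoped ENNReal NNReal ContDiff

namespace Literature.Barriers.AtomisticToContinuum

namespace HeatConduction.RotorChain

open Literature.MathematicalPhysics.KineticTheory.HeatConduction
open Literature.Probability.Distributions Literature.Probability.LatticeModels

variable {N : ℕ}

/-! ### Cauchy–Schwarz for integrals -/

/-- **Cauchy–Schwarz**: if `|X| ≤ K √A √B` pointwise with `A, B ≥ 0` integrable and `K ≥ 0`, then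
`|∫ X| ≤ K √(∫ A) √(∫ B)`. [folklore] -/
theorem abs_integral_le_of_abs_le_sqrt_mul_sqrt {Ω : Type*} [MeasurableSpace Ω] {P : Measure Ω}
    {X A B : Ω → ℝ} {K : ℝ} (hK : 0 ≤ K) (hA0 : ∀ x, 0 ≤ A x) (hB0 : ∀ x, 0 ≤ B x)
    (hA : Integrable A P) (hB : Integrable B P)
    (hX : ∀ x, |X x| ≤ K * Real.sqrt (A x) * Real.sqrt (B x)) :
    |∫ x, X x ∂P| ≤ K * Real.sqrt (∫ x, A x ∂P) * Real.sqrt (∫ x, B x ∂P) := by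
  have hsA : MemLp (fun x => Real.sqrt (A x)) (ENNReal.ofReal 2) P := by
    rw [show ENNReal.ofReal 2 = 2 by norm_num]
    refine (memLp_two_iff_integrable_sq (hA.aestronglyMeasurable.aemeasurable.sqrt.aestronglyMeasurable)).2 ?_
    exact hA.congr (ae_of_all _ fun x => (Real.sq_sqrt (hA0 x)).symm)
  have hsB : MemLp (fun x => Real.sqrt (B x)) (ENNReal.ofReal 2) P := by
    rw [show ENNReal.ofReal 2 = 2 by norm_num]
    refine (memLp_two_iff_integrable_sq (hB.aestronglyMeasurable.aemeasurable.sqrt.aestronglyMeasurable)).2 ?_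
    exact hB.congr (ae_of_all _ fun x => (Real.sq_sqrt (hB0 x)).symm)
  have hH := integral_mul_le_Lp_mul_Lq_of_nonneg Real.HolderConjugate.two_two
    (ae_of_all _ fun x => Real.sqrt_nonneg (A x)) (ae_of_all _ fun x => Real.sqrt_nonneg (B x)) hsA hsB
  have eA : (∫ x, Real.sqrt (A x) ^ (2 : ℝ) ∂P) ^ (1 / (2 : ℝ)) = Real.sqrt (∫ x, A x ∂P) := by
    rw [Real.sqrt_eq_rpow]
    congr 1
    exact integral_congr_ae (ae_of_all _ fun x => by
      show Real.sqrt (A x) ^ (2 : ℝ) = A x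
      rw [Real.rpow_two, Real.sq_sqrt (hA0 x)])
  have eB : (∫ x, Real.sqrt (B x) ^ (2 : ℝ) ∂P) ^ (1 / (2 : ℝ)) = Real.sqrt (∫ x, B x ∂P) := by
    rw [Real.sqrt_eq_rpow]
    congr 1
    exact integral_congr_ae (ae_of_all _ fun x => by
      show Real.sqrt (B x) ^ (2 : ℝ) = B x
      rw [Real.rpow_two, Real.sq_sqrt (hB0 x)])
  rw [eA, eB] at hH
  have hprod : Integrable (fun x => Real.sqrt (A x) * Real.sqrt (B x)) P := by
    rw [show ENNReal.ofReal 2 = 2 by norm_num] at hsA hsB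
    exact hsA.integrable_mul hsB
  calc |∫ x, X x ∂P| ≤ ∫ x, |X x| ∂P := abs_integral_le_integral_abs
    _ ≤ ∫ x, K * (Real.sqrt (A x) * Real.sqrt (B x)) ∂P := by
        refine integral_mono_of_nonneg (ae_of_all _ fun x => abs_nonneg _) (hprod.const_mul K)
          (ae_of_all _ fun x => ?_)
        show |X x| ≤ K * (Real.sqrt (A x) * Real.sqrt (B x))
        rw [← mul_assoc]; exact hX x
    _ = K * ∫ x, Real.sqrt (A x) * Real.sqrt (B x) ∂P := integral_const_mul _ _
    _ ≤ K * (Real.sqrt (∫ x, A x ∂P) * Real.sqrt (∫ x, B x ∂P)) := mul_le_mul_of_nonneg_left hH hK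
    _ = _ := by ring

/-! ### Independence of functions of disjoint blocks of i.i.d. coordinates -/

/-- **Functions of disjoint coordinate blocks are uncorrelated under a product law**: if
`Φ` depends only on the coordinates in `S`, `Ψ` only on those in `T`, `S ∩ T = ∅`, then
`∫ ΦΨ d(⊗μ₁) = (∫ Φ)(∫ Ψ)`. [folklore] -/
theorem integral_mul_eq_mul_integral_of_dependsOn_disjoint (μ₁ : Measure ℝ) [IsProbabilityMeasure μ₁]
    {S T : Finset (Fin N)} (hST : Disjoint S T) {Φ Ψ : (Fin N → ℝ) → ℝ}
    (hΦm : Measurable Φ) (hΨm : Measurable Ψ) (hΦ : DependsOn Φ (↑S : Set (Fin N))) (hΨ : DependsOn Ψ (↑T : Set (Fin N))) :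
    ∫ w, Φ w * Ψ w ∂(Measure.pi fun _ : Fin N => μ₁) =
      (∫ w, Φ w ∂(Measure.pi fun _ : Fin N => μ₁)) * ∫ w, Ψ w ∂(Measure.pi fun _ : Fin N => μ₁) := by
  classical
  set P : Measure (Fin N → ℝ) := Measure.pi fun _ : Fin N => μ₁ with hP
  -- independence of the two coordinate blocks
  have hind : iIndepFun (fun (i : Fin N) (w : Fin N → ℝ) => w i) P :=
    iIndepFun_pi (X := fun (_ : Fin N) (t : ℝ) => t) fun _ => aemeasurable_id
  have hXY : IndepFun (fun (w : Fin N → ℝ) (i : S) => w i) (fun (w : Fin N → ℝ) (i : T) => w i) P :=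
    hind.indepFun_finset S T hST fun i => measurable_pi_apply i
  -- factor `Φ`, `Ψ` through the blocks
  set Φ' : (↥S → ℝ) → ℝ := fun y => Φ (updateFinset 0 S y) with hΦ'
  set Ψ' : (↥T → ℝ) → ℝ := fun y => Ψ (updateFinset 0 T y) with hΨ'
  have eΦ : Φ = Φ' ∘ fun (w : Fin N → ℝ) (i : S) => w i := by
    funext w
    exact hΦ fun i hi => by simp [updateFinset, Finset.mem_coe.1 hi]
  have eΨ : Ψ = Ψ' ∘ fun (w : Fin N → ℝ) (i : T) => w i := by
    funext w
    exact hΨ fun i hi => by simp [updateFinset, Finset.mem_coe.1 hi]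
  have hΦ'm : Measurable Φ' := hΦm.comp measurable_updateFinset
  have hΨ'm : Measurable Ψ' := hΨm.comp measurable_updateFinset
  have hind2 : IndepFun Φ Ψ P := by
    rw [eΦ, eΨ]
    exact hXY.comp hΦ'm hΨ'm
  exact hind2.integral_fun_mul_eq_mul_integral hΦm.aestronglyMeasurable hΨm.aestronglyMeasurable

/-! ### Windows -/

/-- If the windows of `f` and `g` overlap then `|a - b| ≤ R_f + R_g`. [folklore] -/
theorem abs_sub_le_of_not_disjoint_windows {a b : Fin N} {Rf Rg : ℝ}
    (h : ¬ Disjoint (Finset.univ.filter fun x : Fin N => |(x.val : ℝ) - a.val| ≤ Rf)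
      (Finset.univ.filter fun x : Fin N => |(x.val : ℝ) - b.val| ≤ Rg)) :
    |(a.val : ℝ) - b.val| ≤ Rf + Rg := by
  rw [Finset.not_disjoint_iff] at h
  obtain ⟨x, hxa, hxb⟩ := h
  rw [Finset.mem_filter_univ] at hxa hxb
  calc |(a.val : ℝ) - b.val| = |((a.val : ℝ) - x.val) + ((x.val : ℝ) - b.val)| := by ring_nf
    _ ≤ |(a.val : ℝ) - x.val| + |(x.val : ℝ) - b.val| := abs_add_le _ _
    _ ≤ Rf + Rg := add_le_add (by rw [abs_sub_comm]; exact hxa) hxb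

end HeatConduction.RotorChain

open Literature.MathematicalPhysics.KineticTheory.HeatConduction HeatConduction HeatConduction.RotorChain
open Literature.Probability.Distributions Literature.Probability.LatticeModels

/-! ### The assembly -/

/-- **(7.1) from its configurational case and the Gaussian Poincaré inequality.** See the module
docstring for the argument; constants `C_d = max(C, 0) + π²T/4`, rate `c`, `ε₁ = β₁T` from those
of `DeRoeckHuveneers2015_decorrelation_config` at the given `γ`. [cite: DeRoeckHuveneers2015, §7 eq. (7.1)] -/
theorem DeRoeckHuveneers2015_decorrelation_of_config (hC : DeRoeckHuveneers2015_decorrelation_config) :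
    DeRoeckHuveneers2015_decorrelation := by
  intro γ hγ T hT
  obtain ⟨C, c, β₁, hc, hβ₁, hconf⟩ := hC γ hγ
  refine ⟨max C 0 + Real.pi ^ 2 / 4 * T, c, β₁ * T, hc, mul_pos hβ₁ hT, ?_⟩
  intro ε hε hε₁ N hN f g a b Rf Rg hfs hgs hfp hgp hfl hgl hf2 hg2 hfpart hgpart hf0 hg0
  -- parameters
  have hNpos : 0 < N := hN.pos
  set β : ℝ := ε / T with hβdef
  have hβ0 : 0 < β := div_pos hε hT
  have hββ₁ : β < β₁ := by rw [hβdef, div_lt_iff₀ hT]; exact hε₁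
  -- the product structure
  have hμ := gibbsMeasure_eq_prod (N := N) hT hε.le hγ
  rw [hμ] at hf2 hg2 hfpart hgpart hf0 hg0 ⊢
  set ν : Measure (Fin N → ℝ) := configGibbs N (ε / T) γ with hν
  set G : Measure (Fin N → ℝ) := Measure.pi fun _ : Fin N => gaussianReal 0 T.toNNReal with hG
  haveI : IsProbabilityMeasure ν := isProbabilityMeasure_configGibbs hβ0.le hγ
  haveI : SFinite ν := sFinite_configGibbs N (ε / T) γ
  haveI : IsProbabilityMeasure G := by rw [hG]; infer_instance
  -- regularity
  have hfc : Continuous f := hfs.continuous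
  have hgc : Continuous g := hgs.continuous
  have hfs1 : ContDiff ℝ 1 f := hfs.of_le (by norm_num)
  have hgs1 : ContDiff ℝ 1 g := hgs.of_le (by norm_num)
  have hQf : ∀ x, Continuous (partialQ x f) := fun x => continuous_partialQ hfs (by simp) x
  have hQg : ∀ x, Continuous (partialQ x g) := fun x => continuous_partialQ hgs (by simp) x
  -- integrability of `f, g, fg`
  have hfm2 : MemLp f 2 (ν.prod G) := (memLp_two_iff_integrable_sq hfc.aestronglyMeasurable).2 hf2
  have hgm2 : MemLp g 2 (ν.prod G) := (memLp_two_iff_integrable_sq hgc.aestronglyMeasurable).2 hg2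
  have hfgi : Integrable (fun z => f z * g z) (ν.prod G) := hfm2.integrable_mul hgm2
  have hfi : Integrable f (ν.prod G) := hfm2.integrable one_le_two
  have hgi : Integrable g (ν.prod G) := hgm2.integrable one_le_two
  -- momentum averages
  set Fb : (Fin N → ℝ) → ℝ := fun w => ∫ q, f (q, w) ∂ν with hFb
  set Gb : (Fin N → ℝ) → ℝ := fun w => ∫ q, g (q, w) ∂ν with hGb
  have hFbm : MemLp Fb 2 G := memLp_two_avgQ hβ0.le hγ G hfc hf2
  have hGbm : MemLp Gb 2 G := memLp_two_avgQ hβ0.le hγ G hgc hg2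
  have hFbGbi : Integrable (fun w => Fb w * Gb w) G := hFbm.integrable_mul hGbm
  have hFbi : Integrable Fb G := hFbm.integrable one_le_two
  have hGbi : Integrable Gb G := hGbm.integrable one_le_two
  have hFbmean : ∫ w, Fb w ∂G = 0 := by rw [hFb, integral_avgQ G hfi]; exact hf0
  have hGbmean : ∫ w, Gb w ∂G = 0 := by rw [hGb, integral_avgQ G hgi]; exact hg0
  have hFbsm : StronglyMeasurable Fb := stronglyMeasurable_avgQ ν hfc
  have hGbsm : StronglyMeasurable Gb := stronglyMeasurable_avgQ ν hgc
  -- sections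
  have hfsec : ∀ w, Integrable (fun q : Fin N → ℝ => f (q, w)) ν := fun w =>
    (memLp_two_sectionQ (ε / T) γ hfc w).integrable one_le_two
  have hgsec : ∀ w, Integrable (fun q : Fin N → ℝ => g (q, w)) ν := fun w =>
    (memLp_two_sectionQ (ε / T) γ hgc w).integrable one_le_two
  have hfgsec : ∀ w, Integrable (fun q : Fin N → ℝ => f (q, w) * g (q, w)) ν := fun w =>
    (memLp_two_sectionQ (ε / T) γ hfc w).integrable_mul (memLp_two_sectionQ (ε / T) γ hgc w)
  -- the fibrewise covariance and its configurational bound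
  set Cov : (Fin N → ℝ) → ℝ := fun w => ∫ q, (f (q, w) - Fb w) * (g (q, w) - Gb w) ∂ν with hCov
  set A : (Fin N → ℝ) → ℝ := fun w => ∑ x, ∫ q, partialQ x f (q, w) ^ 2 ∂ν with hA
  set B : (Fin N → ℝ) → ℝ := fun w => ∑ x, ∫ q, partialQ x g (q, w) ^ 2 ∂ν with hB
  have hA0 : ∀ w, 0 ≤ A w := fun w => Finset.sum_nonneg fun x _ => integral_nonneg fun q => sq_nonneg _
  have hB0 : ∀ w, 0 ≤ B w := fun w => Finset.sum_nonneg fun x _ => integral_nonneg fun q => sq_nonneg _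
  have hCovb : ∀ w, |Cov w| ≤ C * Real.exp (-c * (|(a.val : ℝ) - b.val| - Rf - Rg)) *
      Real.sqrt (A w) * Real.sqrt (B w) := by
    intro w
    have hu0 : ∫ q, (f (q, w) - Fb w) ∂ν = 0 := by
      rw [integral_sub (hfsec w) (integrable_const _), integral_const]; simp [hFb]
    have hv0 : ∫ q, (g (q, w) - Gb w) ∂ν = 0 := by
      rw [integral_sub (hgsec w) (integrable_const _), integral_const]; simp [hGb]
    have h := hconf β hβ0 hββ₁ N hNpos (fun q => f (q, w) - Fb w) (fun q => g (q, w) - Gb w) a b Rf Rg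
      ((contDiff_sectionQ hfs w).sub contDiff_const) ((contDiff_sectionQ hgs w).sub contDiff_const)
      (isConfigPeriodic_sectionQ hfp w _) (isConfigPeriodic_sectionQ hgp w _)
      (dependsOnlyNearConfig_sectionQ hfl w _) (dependsOnlyNearConfig_sectionQ hgl w _) hu0 hv0
    have eA : configGradSqNorm ν (fun q => f (q, w) - Fb w) = A w := by
      rw [configGradSqNorm_def]
      refine Finset.sum_congr rfl fun x _ => integral_congr_ae (ae_of_all _ fun q => ?_)
      show partialConfig x (fun q => f (q, w) - Fb w) q ^ 2 = partialQ x f (q, w) ^ 2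
      rw [partialConfig_sectionQ_sub_const]
    have eB : configGradSqNorm ν (fun q => g (q, w) - Gb w) = B w := by
      rw [configGradSqNorm_def]
      refine Finset.sum_congr rfl fun x _ => integral_congr_ae (ae_of_all _ fun q => ?_)
      show partialConfig x (fun q => g (q, w) - Gb w) q ^ 2 = partialQ x g (q, w) ^ 2
      rw [partialConfig_sectionQ_sub_const]
    rw [eA, eB] at h
    exact h
  -- integrability of `A`, `B` and their integrals
  have hQ2i : ∀ x, Integrable (fun w => ∫ q, partialQ x f (q, w) ^ 2 ∂ν) G := fun x =>
    (hfpart x).1.integral_prod_right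
  have hQ2i' : ∀ x, Integrable (fun w => ∫ q, partialQ x g (q, w) ^ 2 ∂ν) G := fun x =>
    (hgpart x).1.integral_prod_right
  have hAi : Integrable A G := integrable_finsetSum _ fun x _ => hQ2i x
  have hBi : Integrable B G := integrable_finsetSum _ fun x _ => hQ2i' x
  have hAint : ∫ w, A w ∂G = ∑ x, ∫ z, partialQ x f z ^ 2 ∂(ν.prod G) := by
    rw [hA, integral_finsetSum _ fun x _ => hQ2i x]
    exact Finset.sum_congr rfl fun x _ => (integral_prod_symm _ (hfpart x).1).symm
  have hBint : ∫ w, B w ∂G = ∑ x, ∫ z, partialQ x g z ^ 2 ∂(ν.prod G) := by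
    rw [hB, integral_finsetSum _ fun x _ => hQ2i' x]
    exact Finset.sum_congr rfl fun x _ => (integral_prod_symm _ (hgpart x).1).symm
  -- `gradSqNorm` dominates both the `q`- and the `ω`-Dirichlet forms
  have hGSf_q : ∑ x, ∫ z, partialQ x f z ^ 2 ∂(ν.prod G) ≤ gradSqNorm (ν.prod G) f := by
    rw [gradSqNorm_def]
    exact Finset.sum_le_sum fun x _ => le_add_of_nonneg_right (integral_nonneg fun z => sq_nonneg _)
  have hGSg_q : ∑ x, ∫ z, partialQ x g z ^ 2 ∂(ν.prod G) ≤ gradSqNorm (ν.prod G) g := by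
    rw [gradSqNorm_def]
    exact Finset.sum_le_sum fun x _ => le_add_of_nonneg_right (integral_nonneg fun z => sq_nonneg _)
  have hGSf_p : ∑ x, ∫ z, partialP x f z ^ 2 ∂(ν.prod G) ≤ gradSqNorm (ν.prod G) f := by
    rw [gradSqNorm_def]
    exact Finset.sum_le_sum fun x _ => le_add_of_nonneg_left (integral_nonneg fun z => sq_nonneg _)
  have hGSg_p : ∑ x, ∫ z, partialP x g z ^ 2 ∂(ν.prod G) ≤ gradSqNorm (ν.prod G) g := by
    rw [gradSqNorm_def]
    exact Finset.sum_le_sum fun x _ => le_add_of_nonneg_left (integral_nonneg fun z => sq_nonneg _)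
  have hGS0f : 0 ≤ gradSqNorm (ν.prod G) f :=
    le_trans (Finset.sum_nonneg fun x _ => integral_nonneg fun z => sq_nonneg _) hGSf_q
  have hGS0g : 0 ≤ gradSqNorm (ν.prod G) g :=
    le_trans (Finset.sum_nonneg fun x _ => integral_nonneg fun z => sq_nonneg _) hGSg_q
  -- (1) `⟨fg⟩ = ∫ Cov + ∫ F̄Ḡ`
  have hsplit_w : ∀ w, ∫ q, f (q, w) * g (q, w) ∂ν = Cov w + Fb w * Gb w := by
    intro w
    have e : ∀ q : Fin N → ℝ, (f (q, w) - Fb w) * (g (q, w) - Gb w) =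
        f (q, w) * g (q, w) - Fb w * g (q, w) - Gb w * f (q, w) + Fb w * Gb w := fun q => by ring
    have i_fg : Integrable (fun q : Fin N → ℝ => f (q, w) * g (q, w)) ν := hfgsec w
    have i_g : Integrable (fun q : Fin N → ℝ => Fb w * g (q, w)) ν := (hgsec w).const_mul _
    have i_f : Integrable (fun q : Fin N → ℝ => Gb w * f (q, w)) ν := (hfsec w).const_mul _
    have i1 : Integrable (fun q : Fin N → ℝ => f (q, w) * g (q, w) - Fb w * g (q, w)) ν := i_fg.sub i_g
    have i2 : Integrable (fun q : Fin N → ℝ => f (q, w) * g (q, w) - Fb w * g (q, w) - Gb w * f (q, w)) ν :=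
      i1.sub i_f
    have hCw : Cov w = ∫ q, f (q, w) * g (q, w) ∂ν - Fb w * Gb w := by
      simp only [hCov]
      simp_rw [e]
      rw [integral_add i2 (integrable_const _), integral_sub i1 i_f, integral_sub i_fg i_g,
        integral_const_mul, integral_const_mul, integral_const, probReal_univ, one_smul]
      simp only [hFb, hGb]
      ring
    rw [hCw]
    ring
  have hinner : Integrable (fun w => ∫ q, f (q, w) * g (q, w) ∂ν) G := hfgi.integral_prod_right
  have hCovi : Integrable Cov G := by
    have e : Cov = fun w => (∫ q, f (q, w) * g (q, w) ∂ν) - Fb w * Gb w := by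
      funext w; rw [hsplit_w w]; ring
    rw [e]
    exact hinner.sub hFbGbi
  have hsplit : ∫ z, f z * g z ∂(ν.prod G) = ∫ w, Cov w ∂G + ∫ w, Fb w * Gb w ∂G := by
    rw [integral_prod_symm _ hfgi]
    simp_rw [hsplit_w]
    exact integral_add hCovi hFbGbi
  -- (2) the covariance term
  have hexp0 : 0 ≤ Real.exp (-c * (|(a.val : ℝ) - b.val| - Rf - Rg)) := (Real.exp_pos _).le
  have hCovInt : |∫ w, Cov w ∂G| ≤ max C 0 * Real.exp (-c * (|(a.val : ℝ) - b.val| - Rf - Rg)) *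
      Real.sqrt (gradSqNorm (ν.prod G) f) * Real.sqrt (gradSqNorm (ν.prod G) g) := by
    have hK : 0 ≤ max C 0 * Real.exp (-c * (|(a.val : ℝ) - b.val| - Rf - Rg)) := mul_nonneg (le_max_right _ _) hexp0
    have h1 := abs_integral_le_of_abs_le_sqrt_mul_sqrt (P := G) hK hA0 hB0 hAi hBi fun w =>
      (hCovb w).trans (mul_le_mul_of_nonneg_right (mul_le_mul_of_nonneg_right
        (mul_le_mul_of_nonneg_right (le_max_left C 0) hexp0) (Real.sqrt_nonneg _)) (Real.sqrt_nonneg _))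
    refine h1.trans ?_
    rw [hAint, hBint]
    exact mul_le_mul (mul_le_mul_of_nonneg_left (Real.sqrt_le_sqrt hGSf_q) hK) (Real.sqrt_le_sqrt hGSg_q)
      (Real.sqrt_nonneg _) (mul_nonneg hK (Real.sqrt_nonneg _))
  -- (3) the `F̄Ḡ` term
  have hFG : |∫ w, Fb w * Gb w ∂G| ≤ Real.pi ^ 2 / 4 * T * Real.exp (-c * (|(a.val : ℝ) - b.val| - Rf - Rg)) *
      Real.sqrt (gradSqNorm (ν.prod G) f) * Real.sqrt (gradSqNorm (ν.prod G) g) := by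
    classical
    by_cases hdis : Disjoint (Finset.univ.filter fun x : Fin N => |(x.val : ℝ) - a.val| ≤ Rf)
        (Finset.univ.filter fun x : Fin N => |(x.val : ℝ) - b.val| ≤ Rg)
    · -- disjoint windows: independence
      have h0 : ∫ w, Fb w * Gb w ∂G = 0 := by
        rw [hG, integral_mul_eq_mul_integral_of_dependsOn_disjoint (gaussianReal 0 T.toNNReal) hdis
          hFbsm.measurable hGbsm.measurable
          (fun w w' h => avgQ_eq_of_eqOn ν hfl fun x hx => h x (by simpa using hx))
          (fun w w' h => avgQ_eq_of_eqOn ν hgl fun x hx => h x (by simpa using hx))]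
        rw [← hG, hFbmean, zero_mul]
      rw [h0, abs_zero]
      positivity
    · -- overlapping windows: no decay needed, Gaussian variance bound
      have hd : |(a.val : ℝ) - b.val| - Rf - Rg ≤ 0 := by linarith [abs_sub_le_of_not_disjoint_windows hdis]
      have hexp1 : 1 ≤ Real.exp (-c * (|(a.val : ℝ) - b.val| - Rf - Rg)) := by
        rw [← Real.exp_zero]; exact Real.exp_le_exp.2 (by nlinarith)
      have hVf := integral_sq_avgQ_le hT hβ0.le hγ hfs1 hf2 (fun x => (hfpart x).2) hf0
      have hVg := integral_sq_avgQ_le hT hβ0.le hγ hgs1 hg2 (fun x => (hgpart x).2) hg0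
      have hCS : |∫ w, Fb w * Gb w ∂G| ≤ Real.sqrt (∫ w, Fb w ^ 2 ∂G) * Real.sqrt (∫ w, Gb w ^ 2 ∂G) := by
        have h := abs_integral_le_of_abs_le_sqrt_mul_sqrt (P := G) (K := 1) zero_le_one (fun w => sq_nonneg (Fb w))
          (fun w => sq_nonneg (Gb w)) hFbm.integrable_sq hGbm.integrable_sq fun w => by
            rw [Real.sqrt_sq_eq_abs, Real.sqrt_sq_eq_abs, one_mul, abs_mul]
        simpa using h
      have hκ0 : 0 ≤ Real.pi ^ 2 / 4 * T := by positivity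
      have hXY0 : 0 ≤ Real.sqrt (gradSqNorm (ν.prod G) f) * Real.sqrt (gradSqNorm (ν.prod G) g) :=
        mul_nonneg (Real.sqrt_nonneg _) (Real.sqrt_nonneg _)
      calc |∫ w, Fb w * Gb w ∂G| ≤ Real.sqrt (∫ w, Fb w ^ 2 ∂G) * Real.sqrt (∫ w, Gb w ^ 2 ∂G) := hCS
        _ ≤ Real.sqrt (Real.pi ^ 2 / 4 * T * gradSqNorm (ν.prod G) f) *
              Real.sqrt (Real.pi ^ 2 / 4 * T * gradSqNorm (ν.prod G) g) :=
            mul_le_mul (Real.sqrt_le_sqrt (hVf.trans (mul_le_mul_of_nonneg_left hGSf_p hκ0)))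
              (Real.sqrt_le_sqrt (hVg.trans (mul_le_mul_of_nonneg_left hGSg_p hκ0)))
              (Real.sqrt_nonneg _) (Real.sqrt_nonneg _)
        _ = Real.pi ^ 2 / 4 * T * (Real.sqrt (gradSqNorm (ν.prod G) f) * Real.sqrt (gradSqNorm (ν.prod G) g)) := by
            rw [Real.sqrt_mul hκ0, Real.sqrt_mul hκ0]
            have hs : Real.sqrt (Real.pi ^ 2 / 4 * T) * Real.sqrt (Real.pi ^ 2 / 4 * T) = Real.pi ^ 2 / 4 * T :=
              Real.mul_self_sqrt hκ0
            calc Real.sqrt (Real.pi ^ 2 / 4 * T) * Real.sqrt (gradSqNorm (ν.prod G) f) *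
                  (Real.sqrt (Real.pi ^ 2 / 4 * T) * Real.sqrt (gradSqNorm (ν.prod G) g))
                = (Real.sqrt (Real.pi ^ 2 / 4 * T) * Real.sqrt (Real.pi ^ 2 / 4 * T)) *
                    (Real.sqrt (gradSqNorm (ν.prod G) f) * Real.sqrt (gradSqNorm (ν.prod G) g)) := by ring
              _ = _ := by rw [hs]
        _ ≤ Real.pi ^ 2 / 4 * T * Real.exp (-c * (|(a.val : ℝ) - b.val| - Rf - Rg)) *
              (Real.sqrt (gradSqNorm (ν.prod G) f) * Real.sqrt (gradSqNorm (ν.prod G) g)) :=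
            mul_le_mul_of_nonneg_right (le_mul_of_one_le_right hκ0 hexp1) hXY0
        _ = _ := by ring
  -- (4) conclusion
  rw [hsplit]
  calc |∫ w, Cov w ∂G + ∫ w, Fb w * Gb w ∂G| ≤ |∫ w, Cov w ∂G| + |∫ w, Fb w * Gb w ∂G| := abs_add_le _ _
    _ ≤ _ := add_le_add hCovInt hFG
    _ = _ := by ring

/-- **Discharge of the named fact `DeRoeckHuveneers2015_decorrelation`** (De Roeck–Huveneers 2015,
eq. (7.1): exponential decorrelation of the Gibbs state of the rotor chain at small coupling, with
Dirichlet-form right-hand side, uniformly in `N`): assembled from the configurational case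
`DeRoeckHuveneers2015_decorrelation_config_holds` (transfer-operator / martingale method for the
one-dimensional chain of planar rotors) and the Gaussian Poincaré inequality in the momenta. The
proof is thus not the Witten-Laplacian/semigroup argument of Helffer–Ledoux cited in the source,
but it proves exactly the statement used there. [cite: DeRoeckHuveneers2015, §7 eq. (7.1)] -/
theorem DeRoeckHuveneers2015_decorrelation_holds : DeRoeckHuveneers2015_decorrelation :=
  DeRoeckHuveneers2015_decorrelation_of_config DeRoeckHuveneers2015_decorrelation_config_holds

/-- **De Roeck–Huveneers 2015, Theorem 2 from Theorem 1 alone.** The barrier fact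
`DeRoeckHuveneers2015_thm2` (the finite-time Green–Kubo conductivity of the rotor chain is `o(ε^m)`
on every time scale `ε^{-n}t`, `1 ≤ m < n`) follows from the paper's main theorem
`DeRoeckHuveneers2015_thm1` (decomposition of the current, §§3–6) by the printed proof of §7, ALL of
whose other inputs are now theorems of the tree: stationarity of the Gibbs state
(`GibbsStationarity_holds`, Liouville) and the decorrelation inequality (7.1)
(`DeRoeckHuveneers2015_decorrelation_holds`). [cite: DeRoeckHuveneers2015, §7 proof of Thm 2] -/
theorem DeRoeckHuveneers2015_thm2_of_thm1_alone (h1 : DeRoeckHuveneers2015_thm1) : DeRoeckHuveneers2015_thm2 :=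
  DeRoeckHuveneers2015_thm2_of_thm1_of_decorrelation h1 DeRoeckHuveneers2015_decorrelation_holds

end Literature.Barriers.AtomisticToContinuum

end
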